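import Summits.QuantumFields.YangMills.Theorems.SwapVirialDeficitZeroModeGroupThreeAxis
import HarnessLib

/-!
# Exact zero-mode rung on the GROUP, three letters — III: blowing up the transverse directions (`β²ψ_β = ∫∫ h_β`)
# (rung Z4 in Laplace form; LEAD ym-line-sfw-p2 g93's «exact zero-mode asymptotics»; free-hands support of ⟨stmt-QuantumFields-24197⟩)

With the hub on the `I`-axis, `a = a₀ + r·i`, the commutators of the other two letters with `a` only see their `(J,K)`-components:
`‖xa − ax‖² = 4r²(x_J² + x_K²)` (✓`ToronLog.norm_comm_sq`).  The transverse dilation `D_t : (x₀, x_I, x_J, x_K) ↦ (x₀, x_I, t x_J, t x_K)` (§1,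
`det D_t = t²`, change of variables §2) with `t = β^{−1/2}` absorbs the factor `β²` exactly:
★★ `sq_mul_psiCone_eq` — `β²·ψ_β(a) = coneConst²·∫∫ 𝟙_B(D_t x) 𝟙_B(D_t y) e^{−β·blockThree(D_t x, D_t y, a)} dx dy` for `β > 0` and every hub `a` (§3);
and the rescaled exponent is explicit and β-REGULAR (§4, ★ `mul_blockThree_dilate`): for `a = a₀ + r·i`,
`β·blockThree(D_t x, D_t y, a) = 4r²(x_J²+x_K²)/(N_t(x)‖a‖²) + 4r²(y_J²+y_K²)/(N_t(y)‖a‖²) + 4[(x_K y_I − x_I y_K)² + (x_I y_J − x_J y_I)² + t²(x_J y_K − x_K y_J)²]/(N_t(x)N_t(y))`,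
`N_t(x) = x₀² + x_I² + t²(x_J² + x_K²) = ‖D_t x‖²`.  Part IV: dominated convergence as `t → 0`.
HONEST LABEL: finite-dimensional measure theory on `SU(2)³` (plan-level zero-mode rung); NOT the fixed-`L` sharp law, NOT ⟨24197⟩; the Yang–Mills mass gap is
NOT proved; no summit is proved by a line.  Width seat ym-line-sfw-p2-w2 g55 (cell ym-idea-1, free hands; own crux ⟨22884⟩ blocked-on ⟨19935⟩),
`--supports stmt-QuantumFields-24197`.  Standard axioms, 0 `sorry`; the three local instances of the ToronLog files.
References: [cite: GonzalezarroyoAltes1988]; [cite: Vanbaal2001]; [folklore].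
-/

set_option autoImplicit false

noncomputable section

open MeasureTheory Quaternion Set
open scoped Quaternion ENNReal BigOperators
open Literature.MathematicalPhysics.QuantumLattice
open Literature.MathematicalPhysics.QuantumFieldTheory (haarProbability)
open Summit.QuantumFields.YangMills.Theorems.SwapTwistDeficit.ToronLog

attribute [local instance] Literature.Analysis.FluidPDE.Tao2016.quatMeasurableSpace
  Literature.Analysis.FluidPDE.Tao2016.quatBorelSpace
  Literature.MathematicalPhysics.QuantumLattice.secondCountableTopology_su2

namespace Summit.QuantumFields.YangMills.Theorems.SwapVirialDeficit.ZeroModeGroup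

/-! ## §1 The transverse dilation `D_t` -/

/-- Coordinates `ℝ⁴ ≃ ℝ⁴` (WithLp bookkeeping). [folklore] -/
def eX4 : (Fin 4 → ℝ) ≃ₗ[ℝ] EuclideanSpace ℝ (Fin 4) := (WithLp.linearEquiv 2 ℝ (Fin 4 → ℝ)).symm

/-- The diagonal map `diag(1, 1, t, t)` on `ℝ⁴`. [folklore] -/
def diag4 (t : ℝ) : EuclideanSpace ℝ (Fin 4) →ₗ[ℝ] EuclideanSpace ℝ (Fin 4) :=
  eX4.toLinearMap ∘ₗ (Matrix.toLin' (Matrix.diagonal ![1, 1, t, t]) ∘ₗ eX4.symm.toLinearMap)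

/-- `diag4` in coordinates. [folklore] -/
theorem diag4_apply (t : ℝ) (u : EuclideanSpace ℝ (Fin 4)) (i : Fin 4) : (diag4 t u) i = (![1, 1, t, t] i) * u i := by
  simp [diag4, eX4, Matrix.toLin'_apply, Matrix.mulVec_diagonal]

/-- `det diag(1,1,t,t) = t²`. [folklore] -/
theorem det_diag4 (t : ℝ) : LinearMap.det (diag4 t) = t ^ 2 := by
  unfold diag4
  rw [LinearMap.det_conj (Matrix.toLin' (Matrix.diagonal ![1, 1, t, t])) eX4, LinearMap.det_toLin', Matrix.det_diagonal,
    Fin.prod_univ_four]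
  simp; ring

/-- The transverse dilation `D_t (x₀, x_I, x_J, x_K) = (x₀, x_I, t·x_J, t·x_K)` as a linear map of `ℍ`: the conjugate of `diag(1,1,t,t)` by the
coordinate isometry ✓`Quaternion.linearIsometryEquivTuple`. [folklore] -/
def dilate (t : ℝ) : ℍ →ₗ[ℝ] ℍ :=
  Quaternion.linearIsometryEquivTuple.toLinearEquiv.symm.toLinearMap ∘ₗ
    (diag4 t ∘ₗ Quaternion.linearIsometryEquivTuple.toLinearEquiv.symm.symm.toLinearMap)

/-- `det D_t = t²`. [folklore] -/
theorem det_dilate (t : ℝ) : LinearMap.det (dilate t) = t ^ 2 := by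
  unfold dilate
  rw [LinearMap.det_conj (diag4 t) Quaternion.linearIsometryEquivTuple.toLinearEquiv.symm, det_diag4]

/-- `D_t` in coordinates. [folklore] -/
theorem dilate_apply (t : ℝ) (x : ℍ) : dilate t x = ⟨x.re, x.imI, t * x.imJ, t * x.imK⟩ := by
  have h : dilate t x = Quaternion.linearIsometryEquivTuple.symm (diag4 t (Quaternion.linearIsometryEquivTuple x)) := rfl
  rw [h, Quaternion.linearIsometryEquivTuple_symm_apply]
  have hc : ∀ i : Fin 4, (diag4 t (Quaternion.linearIsometryEquivTuple x)) i = (![1, 1, t, t] i) * (Quaternion.linearIsometryEquivTuple x) i :=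
    fun i => diag4_apply t _ i
  rw [hc 0, hc 1, hc 2, hc 3]
  simp [Quaternion.linearIsometryEquivTuple_apply]

/-- Components of `D_t x`. [folklore] -/
theorem dilate_re (t : ℝ) (x : ℍ) : (dilate t x).re = x.re := by rw [dilate_apply]
/-- Components of `D_t x`. [folklore] -/
theorem dilate_imI (t : ℝ) (x : ℍ) : (dilate t x).imI = x.imI := by rw [dilate_apply]
/-- Components of `D_t x`. [folklore] -/
theorem dilate_imJ (t : ℝ) (x : ℍ) : (dilate t x).imJ = t * x.imJ := by rw [dilate_apply]
/-- Components of `D_t x`. [folklore] -/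
theorem dilate_imK (t : ℝ) (x : ℍ) : (dilate t x).imK = t * x.imK := by rw [dilate_apply]

/-- `‖D_t x‖² = x₀² + x_I² + t²(x_J² + x_K²)`. [folklore] -/
theorem norm_sq_dilate (t : ℝ) (x : ℍ) : ‖dilate t x‖ ^ 2 = x.re ^ 2 + x.imI ^ 2 + t ^ 2 * (x.imJ ^ 2 + x.imK ^ 2) := by
  rw [sq, ← Quaternion.normSq_eq_norm_mul_self, Quaternion.normSq_def', dilate_apply]
  simp only
  ring

/-! ## §2 Change of variables under `D_t` -/

/-- CHANGE OF VARIABLES under the transverse dilation (`t ≠ 0`): `∫ g(D_t y) dy = (t²)⁻¹·∫ g`. [folklore] -/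
theorem lintegral_comp_dilate {t : ℝ} (ht : t ≠ 0) (g : ℍ → ℝ≥0∞) (hg : Measurable g) :
    ∫⁻ y, g (dilate t y) = ENNReal.ofReal ((t ^ 2)⁻¹) * ∫⁻ y, g y := by
  have hdet : LinearMap.det (dilate t) ≠ 0 := by rw [det_dilate]; positivity
  have hD : Measurable (dilate t) := (LinearMap.continuous_of_finiteDimensional _).measurable
  rw [← lintegral_map hg hD, Measure.map_linearMap_addHaar_eq_smul_addHaar _ hdet, lintegral_smul_measure, det_dilate, smul_eq_mul,
    abs_inv, abs_of_nonneg (sq_nonneg t)]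

/-- The same, solved for `∫ g`: `∫ g = t²·∫ g(D_t y) dy` (`t ≠ 0`). [folklore] -/
theorem lintegral_eq_sq_mul_lintegral_comp_dilate {t : ℝ} (ht : t ≠ 0) (g : ℍ → ℝ≥0∞) (hg : Measurable g) :
    ∫⁻ y, g y = ENNReal.ofReal (t ^ 2) * ∫⁻ y, g (dilate t y) := by
  have ht2 : 0 < t ^ 2 := by positivity
  rw [lintegral_comp_dilate ht g hg, ← mul_assoc, ← ENNReal.ofReal_mul ht2.le, mul_inv_cancel₀ ht2.ne', ENNReal.ofReal_one, one_mul]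

/-! ## §3 The scaling identity `β²·ψ_β(a) = coneConst²·∫∫ h_β` -/

/-- The cone-measure integral as a ball-indicator Lebesgue integral: `∫ f dcone = coneConst·∫ 𝟙_B·f`. [folklore] -/
theorem lintegral_coneMeasure_eq (f : ℍ → ℝ≥0∞) :
    ∫⁻ x, f x ∂coneMeasure = ENNReal.ofReal coneConst * ∫⁻ x, (Metric.ball (0 : ℍ) 1).indicator f x := by
  rw [coneMeasure, lintegral_smul_measure, lintegral_indicator measurableSet_ball, inv_volume_ball_eq, smul_eq_mul]

/-- The inner pair integral as an iterated ball-indicator Lebesgue integral: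
`ψ_β(a) = coneConst²·∫ 𝟙_B(x)·(∫ 𝟙_B(y)·e^{−β·blockThree x y a} dy) dx`. [folklore] -/
theorem psiCone_eq_lintegral_lintegral (β : ℝ) (a : ℍ) :
    psiCone β a = ENNReal.ofReal coneConst * (ENNReal.ofReal coneConst *
      ∫⁻ x, (Metric.ball (0 : ℍ) 1).indicator
        (fun x => ∫⁻ y, (Metric.ball (0 : ℍ) 1).indicator (fun y => ENNReal.ofReal (Real.exp (-(β * blockThree x y a)))) y) x) := by
  haveI := isProbabilityMeasure_coneMeasure
  have hF : Measurable fun p : ℍ × ℍ => ENNReal.ofReal (Real.exp (-(β * blockThree p.1 p.2 a))) :=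
    (measurable_expBlock β).comp (measurable_fst.prodMk (measurable_snd.prodMk measurable_const))
  rw [psiCone_def, lintegral_prod _ hF.aemeasurable]
  have hin : ∀ x, ∫⁻ y, ENNReal.ofReal (Real.exp (-(β * blockThree x y a))) ∂coneMeasure =
      ENNReal.ofReal coneConst * ∫⁻ y, (Metric.ball (0 : ℍ) 1).indicator (fun y => ENNReal.ofReal (Real.exp (-(β * blockThree x y a)))) y :=
    fun x => lintegral_coneMeasure_eq _
  simp_rw [hin]
  have hmeas : Measurable fun x => ∫⁻ y, (Metric.ball (0 : ℍ) 1).indicator (fun y => ENNReal.ofReal (Real.exp (-(β * blockThree x y a)))) y := by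
    have h2 : Measurable fun p : ℍ × ℍ =>
        (Metric.ball (0 : ℍ) 1).indicator (fun y => ENNReal.ofReal (Real.exp (-(β * blockThree p.1 y a)))) p.2 := by
      have e : (fun p : ℍ × ℍ => (Metric.ball (0 : ℍ) 1).indicator (fun y => ENNReal.ofReal (Real.exp (-(β * blockThree p.1 y a)))) p.2) =
          (Set.univ ×ˢ Metric.ball (0 : ℍ) 1).indicator (fun p : ℍ × ℍ => ENNReal.ofReal (Real.exp (-(β * blockThree p.1 p.2 a)))) := by
        funext p
        by_cases hp : p.2 ∈ Metric.ball (0 : ℍ) 1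
        · rw [Set.indicator_of_mem hp, Set.indicator_of_mem (Set.mk_mem_prod (Set.mem_univ _) hp)]
        · rw [Set.indicator_of_notMem hp, Set.indicator_of_notMem (fun h => hp h.2)]
      rw [e]
      exact hF.indicator (MeasurableSet.univ.prod measurableSet_ball)
    exact h2.lintegral_prod_right'
  rw [lintegral_const_mul _ hmeas, lintegral_coneMeasure_eq _]

/-- ★★ **THE SCALING IDENTITY** — for `β > 0`, `t = (√β)⁻¹` and every hub `a`:
`β²·ψ_β(a) = coneConst²·∫ 𝟙_B(D_t x)·(∫ 𝟙_B(D_t y)·e^{−β·blockThree(D_t x, D_t y, a)} dy) dx` (the Jacobian `t⁴ = β⁻²` of the two transverse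
dilations cancels the prefactor). [folklore] -/
theorem sq_mul_psiCone_eq {β : ℝ} (hβ : 0 < β) (a : ℍ) :
    ENNReal.ofReal (β ^ 2) * psiCone β a = ENNReal.ofReal coneConst * (ENNReal.ofReal coneConst *
      ∫⁻ x, (Metric.ball (0 : ℍ) 1).indicator
        (fun z => ∫⁻ y, (Metric.ball (0 : ℍ) 1).indicator
          (fun w => ENNReal.ofReal (Real.exp (-(β * blockThree z w a)))) (dilate (Real.sqrt β)⁻¹ y)) (dilate (Real.sqrt β)⁻¹ x)) := by
  set t : ℝ := (Real.sqrt β)⁻¹ with ht_def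
  have hsq : 0 < Real.sqrt β := Real.sqrt_pos.2 hβ
  have ht : t ≠ 0 := inv_ne_zero hsq.ne'
  have ht2 : t ^ 2 = β⁻¹ := by rw [ht_def, inv_pow, Real.sq_sqrt hβ.le]
  have hF : Measurable fun p : ℍ × ℍ => ENNReal.ofReal (Real.exp (-(β * blockThree p.1 p.2 a))) :=
    (measurable_expBlock β).comp (measurable_fst.prodMk (measurable_snd.prodMk measurable_const))
  -- the inner function and its measurability (plain and precomposed with the dilation)
  have hD : Measurable (dilate t) := (LinearMap.continuous_of_finiteDimensional _).measurable
  have hGy : ∀ z : ℍ, Measurable fun y => (Metric.ball (0 : ℍ) 1).indicator (fun w => ENNReal.ofReal (Real.exp (-(β * blockThree z w a)))) y :=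
    fun z => (hF.comp (measurable_const.prodMk measurable_id)).indicator measurableSet_ball
  have hinner : ∀ z : ℍ, ∫⁻ y, (Metric.ball (0 : ℍ) 1).indicator (fun w => ENNReal.ofReal (Real.exp (-(β * blockThree z w a)))) y =
      ENNReal.ofReal (t ^ 2) * ∫⁻ y, (Metric.ball (0 : ℍ) 1).indicator (fun w => ENNReal.ofReal (Real.exp (-(β * blockThree z w a)))) (dilate t y) :=
    fun z => lintegral_eq_sq_mul_lintegral_comp_dilate ht _ (hGy z)
  -- measurability of the outer integrand `x ↦ ∫ 𝟙_B(D_t y) F(x, D_t y) dy`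
  have hH : Measurable fun p : ℍ × ℍ =>
      (Metric.ball (0 : ℍ) 1).indicator (fun w => ENNReal.ofReal (Real.exp (-(β * blockThree p.1 w a)))) (dilate t p.2) := by
    have e : (fun p : ℍ × ℍ => (Metric.ball (0 : ℍ) 1).indicator (fun w => ENNReal.ofReal (Real.exp (-(β * blockThree p.1 w a)))) (dilate t p.2)) =
        ((fun p : ℍ × ℍ => dilate t p.2) ⁻¹' Metric.ball (0 : ℍ) 1).indicator
          (fun p : ℍ × ℍ => ENNReal.ofReal (Real.exp (-(β * blockThree p.1 (dilate t p.2) a)))) := by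
      funext p
      by_cases hp : dilate t p.2 ∈ Metric.ball (0 : ℍ) 1
      · rw [Set.indicator_of_mem hp, Set.indicator_of_mem (show p ∈ _ from hp)]
      · rw [Set.indicator_of_notMem hp, Set.indicator_of_notMem (show p ∉ _ from hp)]
    rw [e]
    exact (hF.comp (measurable_fst.prodMk (hD.comp measurable_snd))).indicator (measurableSet_ball.preimage (hD.comp measurable_snd))
  have hG : Measurable fun z : ℍ => ∫⁻ y, (Metric.ball (0 : ℍ) 1).indicator
      (fun w => ENNReal.ofReal (Real.exp (-(β * blockThree z w a)))) (dilate t y) := hH.lintegral_prod_right'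
  have houter := lintegral_eq_sq_mul_lintegral_comp_dilate ht _ (hG.indicator (measurableSet_ball : MeasurableSet (Metric.ball (0 : ℍ) 1)))
  -- assemble
  rw [psiCone_eq_lintegral_lintegral]
  simp_rw [hinner]
  have hpull : (fun x => (Metric.ball (0 : ℍ) 1).indicator (fun x => ENNReal.ofReal (t ^ 2) *
      ∫⁻ y, (Metric.ball (0 : ℍ) 1).indicator (fun w => ENNReal.ofReal (Real.exp (-(β * blockThree x w a)))) (dilate t y)) x) =
      fun x => ENNReal.ofReal (t ^ 2) * (Metric.ball (0 : ℍ) 1).indicator (fun z => ∫⁻ y, (Metric.ball (0 : ℍ) 1).indicator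
        (fun w => ENNReal.ofReal (Real.exp (-(β * blockThree z w a)))) (dilate t y)) x := by
    funext x
    exact Set.indicator_const_mul _ _ _ _
  rw [hpull, lintegral_const_mul _ (hG.indicator (measurableSet_ball : MeasurableSet (Metric.ball (0 : ℍ) 1))), houter]
  have key : ENNReal.ofReal (β ^ 2) * (ENNReal.ofReal (t ^ 2) * ENNReal.ofReal (t ^ 2)) = 1 := by
    rw [← ENNReal.ofReal_mul (sq_nonneg _), ← ENNReal.ofReal_mul (sq_nonneg _), ht2, ← ENNReal.ofReal_one]
    congr 1
    field_simp
  set I := ∫⁻ x, (Metric.ball (0 : ℍ) 1).indicator (fun z => ∫⁻ y, (Metric.ball (0 : ℍ) 1).indicator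
    (fun w => ENNReal.ofReal (Real.exp (-(β * blockThree z w a)))) (dilate t y)) (dilate t x) with hI
  set c := ENNReal.ofReal coneConst with hc
  calc ENNReal.ofReal (β ^ 2) * (c * (c * (ENNReal.ofReal (t ^ 2) * (ENNReal.ofReal (t ^ 2) * I))))
      = (ENNReal.ofReal (β ^ 2) * (ENNReal.ofReal (t ^ 2) * ENNReal.ofReal (t ^ 2))) * (c * (c * I)) := by ring
    _ = c * (c * I) := by rw [key, one_mul]

/-! ## §4 The rescaled exponent at an axis hub is explicit and regular in `t² = β⁻¹` -/

/-- The commutator of a letter with an AXIS hub `a = a₀ + r·i` (`a_J = a_K = 0`) only sees the letter's `(J,K)`-components: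
`‖xa − ax‖² = 4a_I²(x_J² + x_K²)`. [folklore] -/
theorem norm_comm_axis_sq (x a : ℍ) (hJ : a.imJ = 0) (hK : a.imK = 0) :
    ‖x * a - a * x‖ ^ 2 = 4 * (a.imI ^ 2 * (x.imJ ^ 2 + x.imK ^ 2)) := by
  rw [norm_comm_sq, hJ, hK]
  ring

/-- The commutator of two dilated letters: `‖D_tx·D_ty − D_ty·D_tx‖² = t²·4[(x_Ky_I − x_Iy_K)² + (x_Iy_J − x_Jy_I)² + t²(x_Jy_K − x_Ky_J)²]`. [folklore] -/
theorem norm_comm_dilate_sq (t : ℝ) (x y : ℍ) :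
    ‖dilate t x * dilate t y - dilate t y * dilate t x‖ ^ 2 =
      t ^ 2 * (4 * ((x.imK * y.imI - x.imI * y.imK) ^ 2 + (x.imI * y.imJ - x.imJ * y.imI) ^ 2 + t ^ 2 * (x.imJ * y.imK - x.imK * y.imJ) ^ 2)) := by
  rw [norm_comm_sq, dilate_imI, dilate_imJ, dilate_imK, dilate_imI, dilate_imJ, dilate_imK]
  ring

/-- `‖a‖² = a₀² + a_I²` for an axis hub. [folklore] -/
theorem norm_sq_axis (a : ℍ) (hJ : a.imJ = 0) (hK : a.imK = 0) : ‖a‖ ^ 2 = a.re ^ 2 + a.imI ^ 2 := by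
  rw [sq, ← Quaternion.normSq_eq_norm_mul_self, Quaternion.normSq_def']
  simp only [hJ, hK]
  ring

/-- The axis point of part II is an axis hub: `(axisPoint y)_J = (axisPoint y)_K = 0`, `(axisPoint y)_I = ‖Im y‖`, `re = re y`. [folklore] -/
theorem axisPoint_components (y : ℍ) :
    (axisPoint y).re = y.re ∧ (axisPoint y).imI = ‖y.im‖ ∧ (axisPoint y).imJ = 0 ∧ (axisPoint y).imK = 0 := ⟨rfl, rfl, rfl, rfl⟩

/-- ★ **The rescaled exponent at an axis hub** (`β > 0`, `t = (√β)⁻¹`, `a_J = a_K = 0`, `N_t(x) = x₀² + x_I² + t²(x_J² + x_K²)`):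
`β·blockThree(D_tx, D_ty, a) = 4[(x_Ky_I − x_Iy_K)² + (x_Iy_J − x_Jy_I)² + t²(x_Jy_K − x_Ky_J)²]/(N_t(x)N_t(y))
 + 4a_I²(x_J² + x_K²)/(N_t(x)(a₀² + a_I²)) + 4a_I²(y_J² + y_K²)/(N_t(y)(a₀² + a_I²))` — every `β` has become a `t² = β⁻¹ → 0`. [folklore] -/
theorem mul_blockThree_dilate {β : ℝ} (hβ : 0 < β) (a : ℍ) (hJ : a.imJ = 0) (hK : a.imK = 0) (x y : ℍ) :
    β * blockThree (dilate (Real.sqrt β)⁻¹ x) (dilate (Real.sqrt β)⁻¹ y) a =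
      4 * ((x.imK * y.imI - x.imI * y.imK) ^ 2 + (x.imI * y.imJ - x.imJ * y.imI) ^ 2 +
            ((Real.sqrt β)⁻¹) ^ 2 * (x.imJ * y.imK - x.imK * y.imJ) ^ 2) /
          ((x.re ^ 2 + x.imI ^ 2 + ((Real.sqrt β)⁻¹) ^ 2 * (x.imJ ^ 2 + x.imK ^ 2)) *
            (y.re ^ 2 + y.imI ^ 2 + ((Real.sqrt β)⁻¹) ^ 2 * (y.imJ ^ 2 + y.imK ^ 2))) +
        4 * (a.imI ^ 2 * (x.imJ ^ 2 + x.imK ^ 2)) / ((x.re ^ 2 + x.imI ^ 2 + ((Real.sqrt β)⁻¹) ^ 2 * (x.imJ ^ 2 + x.imK ^ 2)) * (a.re ^ 2 + a.imI ^ 2)) +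
        4 * (a.imI ^ 2 * (y.imJ ^ 2 + y.imK ^ 2)) / ((y.re ^ 2 + y.imI ^ 2 + ((Real.sqrt β)⁻¹) ^ 2 * (y.imJ ^ 2 + y.imK ^ 2)) * (a.re ^ 2 + a.imI ^ 2)) := by
  set t : ℝ := (Real.sqrt β)⁻¹ with ht_def
  have ht2 : β * t ^ 2 = 1 := by
    rw [ht_def, inv_pow, Real.sq_sqrt hβ.le, mul_inv_cancel₀ hβ.ne']
  have hxa : ‖dilate t x * a - a * dilate t x‖ ^ 2 = t ^ 2 * (4 * (a.imI ^ 2 * (x.imJ ^ 2 + x.imK ^ 2))) := by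
    rw [norm_comm_axis_sq _ _ hJ hK, dilate_imJ, dilate_imK]; ring
  have hya : ‖dilate t y * a - a * dilate t y‖ ^ 2 = t ^ 2 * (4 * (a.imI ^ 2 * (y.imJ ^ 2 + y.imK ^ 2))) := by
    rw [norm_comm_axis_sq _ _ hJ hK, dilate_imJ, dilate_imK]; ring
  have hfac : ∀ A D : ℝ, β * (t ^ 2 * A / D) = A / D := fun A D => by
    rw [← mul_div_assoc, ← mul_assoc, ht2, one_mul]
  rw [blockThree_def, commSq_def, commSq_def, commSq_def, norm_comm_dilate_sq, hxa, hya, norm_sq_dilate, norm_sq_dilate,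
    norm_sq_axis a hJ hK, mul_add, mul_add, hfac, hfac, hfac]

end Summit.QuantumFields.YangMills.Theorems.SwapVirialDeficit.ZeroModeGroup

end
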